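import Mathlib
import HarnessLib
import Summits.NavierStokesRegularity.NavierStokesRegularity.Theorems.TaylorModelRungThreeCertificateStaticSlack
import Summits.NavierStokesRegularity.NavierStokesRegularity.Theorems.TaylorModelRungThreeCertificateStageNumericsBilin
import Summits.NavierStokesRegularity.NavierStokesRegularity.Theorems.TaylorModelRungThreeCertificateFormatVCoreSound
import Summits.NavierStokesRegularity.NavierStokesRegularity.Theorems.TaylorModelRungThreeCertificateFormatVWindow
import Summits.NavierStokesRegularity.NavierStokesRegularity.Theorems.TaylorModelRungThreeReadoutVLandDeriv
import Summits.NavierStokesRegularity.NavierStokesRegularity.Theorems.TaylorModelRungThreeCertificateReadoutVSoundB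
import Summits.NavierStokesRegularity.NavierStokesRegularity.Theorems.TaylorModelRungThreeCertificateReadoutVInterpP
import Summits.NavierStokesRegularity.NavierStokesRegularity.Theorems.TaylorModelRungThreeCertificateFormatVGrowthSound
import Summits.NavierStokesRegularity.NavierStokesRegularity.Theorems.TaylorModelRungThreeCertificateFormatVGrowth2Sound

/-!
# Crux K1b-DR (stmt-NavierStokesRegularity-23954), line `taylor-model` — the v3 CLOSER SHAPE:
# the crux `DerivativeEnclosureCertificateR` from the Boolean checkers of a v3 certificate `TV : CertTablesV`

The v3 analogue of `…CertificateCloser` (v1, `certificate_of_QS2_checks`).  The G-side of the line is complete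
(`TaylorModelV.k1bDR_of_validV`, p629014: `ValidV cd bx rd ro` + «`Dsc` reads the window» ⊢ K1b-DR, witness flow = the S1
selector, crossing time `tauSel`); the K-side replays Booleans on the interpreted records
`TV.toCertDataVW kitOf wT sc / TV.toBoxesW kitOf wT / TV.toRadiiW kitOf wT` (engine-1 g67: `chainV_of_checks`,
`entryOK_of_checkEntryV`, `toRadiiW_Dsc_trunc`; typer g32: the read-out step; the v1 `Static` / `StageNumerics` checkers
on `TV.base`).  This file is the junction:

* `CertTablesV.static_VW` / `stageNumerics_VW` — the v1 blocks of `TV.base.toCertData QS2.toRealHom` ARE those of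
  `TV.toCertDataVW kitOf wT sc` (the record update touches no static field; definitional);
* `CertTablesV.kitOK_of_checkCoef` — `KitOK` for any kit whose coefficient boxes are the rounded `ofQS2` enclosures of the
  table's coefficients and whose monomial table is `monosTable` (both `rfl` for a literal kit), from `checkCoef = true`;
* `CertTablesV.k1bDR_of_validVW` — the crux from `ValidV` of the interpreted records, the window hypothesis of
  `k1bDR_of_validV` discharged by `toRadiiW_Dsc_trunc`;
* `CertTablesV.k1bDR_of_checksV` — THE CLOSER SHAPE: `checkCoef`, `checkStatic`, `checkStageNumerics` (on `TV.base`),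
  `KitOK`, `ChecksOK`, `CoreChecksOK`, `checkEntryV` (all stages) and ONE semantic input `ReadoutsV … ro` (the read-outs
  composer's conclusion) ⊢ `Theses.ExactWindowRungThree.DerivativeEnclosureCertificateR`; `k1bDR_of_checksV_stdKit` —
  the same with `KitOK` replaced by the two `rfl`-shaped kit side conditions.

* (appended) `sigma_trunc_VW` ((R0e) free), `hentry_of_checkEntryV` (the read-out composer's entry-box input from
  `checkEntryV`), `k1bDR_of_checksVR` — the closer with `readoutsV_of_checks` wired in: Booleans + (R0 a–d)/(R1)/(R2)/(R3) only;
  `k1bDR_of_checksVR'` (checkpoint-form read-outs + (R4) from chunk runs); **`k1bDR_of_checksVRG'`** — THE CLOSER FROM BOOLEANS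
  ((R0)–(R3) by the growth checker `…FormatVGrowth*`); `k1bDR_of_checksVRG2'` — the same for the two-level variant
  `…FormatVGrowth2*`.

What remains for the crux is ONE emitted v3 certificate whose Booleans evaluate to `true` and whose read-outs pass.
MODEL-lattice rung TL-M3 only; nothing here is a statement about the Navier–Stokes equations; K1b-DR is NOT proved here.
-/

-- the sub-problem namespace repeats the summit name by design (D-0017)
set_option linter.dupNamespace false

namespace Summit.NavierStokesRegularity.NavierStokesRegularity.Theorems.TaylorModelCert

open Literature.Analysis.FluidPDE.TaoCascade Literature.Analysis.FluidPDE.TaoCascade.TaylorChain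
open Summit.NavierStokesRegularity.NavierStokesRegularity.Theorems.TaylorModelReadout
open Summit.NavierStokesRegularity.NavierStokesRegularity.Theorems.TaylorModelV

namespace CertTablesV

variable (TV : CertTablesV) (kitOf : ℕ → CoreKit) (wT : ℕ → Array Dyad) (sc : ScalarsV)

/-! ### The v1 blocks transfer to the v3 record (definitional) -/

/-- **`Static` transfers**: the v3 record `toCertDataVW` updates only dynamic fields (`h`, `Tn`, `x`, `P`, `Wv`, frames,
radii, `L1`, the v1 scalars) of `TV.base.toCertData QS2.toRealHom`, and `Static` reads none of them. [folklore] -/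
theorem static_VW : (TV.toCertDataVW kitOf wT sc).Static ↔ (TV.base.toCertData QS2.toRealHom).Static := Iff.rfl

/-- **`StageNumerics` transfers** likewise (it reads `nx, Lv, s, κ, Λ, δ, ω, as, ℓ, M, Cb, Cg, θ, η₀, W, α, bb` only). [folklore] -/
theorem stageNumerics_VW :
    (TV.toCertDataVW kitOf wT sc).StageNumerics ↔ (TV.base.toCertData QS2.toRealHom).StageNumerics := Iff.rfl

/-- `Static` of the v3 record from the v1 checker on `TV.base`. [folklore] -/
theorem static_of_checkV (B'' : StaticAux QS2) (hS : TV.base.checkStatic B'' = true) :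
    (TV.toCertDataVW kitOf wT sc).Static :=
  (TV.static_VW kitOf wT sc).2 (TV.base.static_of_check QS2.toRealHom_monotone B'' hS)

/-- `StageNumerics` of the v3 record from the v1 checker on `TV.base` (under `checkCoef`). [folklore] -/
theorem stageNumerics_of_checkV (A : ReadoutAux QS2) (B : StageAux QS2) (hcoef : TV.base.checkCoef = true)
    (hSN : TV.base.checkStageNumerics A B = true) : (TV.toCertDataVW kitOf wT sc).StageNumerics :=
  (TV.stageNumerics_VW kitOf wT sc).2
    (TV.base.stageNumerics_of_check QS2.toRealHom_monotone A B (TV.base.coefOK_of_checkCoef hcoef) hSN)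

/-! ### The kit hypotheses from `checkCoef` -/

/-- **`KitOK` from `checkCoef`** for a kit whose coefficient boxes are the rounded enclosures `ofQS2 p (coefAt …)` (any
precision `p`, per stage) and whose monomial table is `monosTable` of its boxes — both `rfl` for a literal kit. [folklore] -/
theorem kitOK_of_checkCoef (hcoef : TV.base.checkCoef = true)
    (hB : ∀ j, ∃ p : ℕ, (kitOf j).coefB = fun a b i μi k => IntervalD.ofQS2 p (TV.base.coefAt a b i μi k))
    (hmt : ∀ j, (kitOf j).mt = TV.base.monosTable (kitOf j).coefB) : KitOK TV kitOf where
  coef := TV.base.coefOK_of_checkCoef hcoef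
  box j := by
    obtain ⟨p, hp⟩ := hB j
    rw [hp]
    exact CertTables.coefBoxOK_ofQS2 TV.base p
  mt := hmt

/-! ### `ValidV` of the interpreted records and the crux -/

/-- **K1b-DR from a valid v3 certificate** — `k1bDR_of_validV` (G-side, p629014) with its window hypothesis
«`Dsc j v = Dsc j (trunc v)`» DISCHARGED for the interpreted scaling `Dsc j = linF (diag D_j)` (`toRadiiW_Dsc_trunc`).
[folklore] -/
theorem k1bDR_of_validVW {ro : ReadoutData}
    (hV : ValidV (TV.toCertDataVW kitOf wT sc) (TV.toBoxesW kitOf wT) (TV.toRadiiW kitOf wT) ro) :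
    Summit.NavierStokesRegularity.NavierStokesRegularity.Theses.ExactWindowRungThree.DerivativeEnclosureCertificateR :=
  k1bDR_of_validV hV fun j _ v => TV.toRadiiW_Dsc_trunc kitOf wT sc j v

/-- **THE v3 CLOSER SHAPE.** From the replayed Booleans of an emitted certificate `TV` — `checkCoef`, `checkStatic`,
`checkStageNumerics` (v1 checkers on `TV.base`), the kit facts `KitOK` (`kitOK_of_checkCoef`), the chain Booleans
`ChecksOK` (entry-node frame test, `rB ≥ 0`, every sub-step `ok`), `CoreChecksOK` (`1 ≤ S`, `0 < h`, `wT ≥ 0`), the sparse-Farkas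
entry test `checkEntryV` of every stage — and the read-outs `ReadoutsV` of the interpreted records (the read-out composer's
conclusion for `ro := toReadoutData …`), the crux K1b-DR follows BY NAME. [folklore] -/
theorem k1bDR_of_checksV {ro : ReadoutData} (A : ReadoutAux QS2) (B : StageAux QS2) (B'' : StaticAux QS2)
    (hcoef : TV.base.checkCoef = true) (hS : TV.base.checkStatic B'' = true)
    (hSN : TV.base.checkStageNumerics A B = true) (hk : KitOK TV kitOf) (hC : ChecksOK TV kitOf wT)
    (hK : CoreChecksOK TV wT) (hE : ∀ j, j ≤ TV.base.N₀ → TV.checkEntryV j = true)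
    (hRO : ReadoutsV (TV.toCertDataVW kitOf wT sc) (TV.toBoxesW kitOf wT) (TV.toRadiiW kitOf wT) ro) :
    Summit.NavierStokesRegularity.NavierStokesRegularity.Theses.ExactWindowRungThree.DerivativeEnclosureCertificateR :=
  TV.k1bDR_of_validVW kitOf wT sc
    ⟨TV.static_of_checkV kitOf wT sc B'' hS, TV.stageNumerics_of_checkV kitOf wT sc A B hcoef hSN,
      chainV_of_checks hk hC hK (entryOK_of_checkEntryV kitOf wT sc hE), hRO⟩

/-- **The closer for a standard kit** (coefficient boxes `ofQS2 p (coefAt …)`, monomial table `monosTable` — `rfl`-shaped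
side conditions of a literal kit): as `k1bDR_of_checksV` with `KitOK` discharged by `kitOK_of_checkCoef`. [folklore] -/
theorem k1bDR_of_checksV_stdKit {ro : ReadoutData} (A : ReadoutAux QS2) (B : StageAux QS2) (B'' : StaticAux QS2)
    (hcoef : TV.base.checkCoef = true) (hS : TV.base.checkStatic B'' = true)
    (hSN : TV.base.checkStageNumerics A B = true)
    (hB : ∀ j, ∃ p : ℕ, (kitOf j).coefB = fun a b i μi k => IntervalD.ofQS2 p (TV.base.coefAt a b i μi k))
    (hmt : ∀ j, (kitOf j).mt = TV.base.monosTable (kitOf j).coefB) (hC : ChecksOK TV kitOf wT)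
    (hK : CoreChecksOK TV wT) (hE : ∀ j, j ≤ TV.base.N₀ → TV.checkEntryV j = true)
    (hRO : ReadoutsV (TV.toCertDataVW kitOf wT sc) (TV.toBoxesW kitOf wT) (TV.toRadiiW kitOf wT) ro) :
    Summit.NavierStokesRegularity.NavierStokesRegularity.Theses.ExactWindowRungThree.DerivativeEnclosureCertificateR :=
  TV.k1bDR_of_checksV kitOf wT sc A B B'' hcoef hS hSN (TV.kitOK_of_checkCoef kitOf hcoef hB hmt) hC hK hE hRO

/-! ### Appended (tm-g4 g4, after typer g32's `readoutsV_of_checks` p631126): the read-outs composer wired in -/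

/-- **(R0e) is free**: the section functional of the interpreted record reads the window only
(`σf j y = σf j (trunc y)`), because `σf j = covR (stage j).σf` is a window coordinate sum. [folklore] -/
theorem sigma_trunc_VW (j : ℕ) (y : Fin 4 → ℤ → ℝ) :
    (TV.toCertDataVW kitOf wT sc).σf j y = (TV.toCertDataVW kitOf wT sc).σf j (trunc (TV.toCertDataVW kitOf wT sc) y) := by
  show TV.base.covR QS2.toRealHom (TV.base.stage j).σf y =
    TV.base.covR QS2.toRealHom (TV.base.stage j).σf (trunc (TV.toCertDataVW kitOf wT sc) y)
  rw [TV.base.covR_apply, TV.base.covR_apply]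
  exact Finset.sum_congr rfl fun c hc => by rw [TV.base.wv_trunc_cd _ cd_Kb cd_Ka y (Finset.mem_range.1 hc)]

/-- **The entry-box hypothesis `hentry` of `readoutsV_of_checks` from the entry check**: `checkEntryV j` certifies `0 < D_{j,c}`
for every window coordinate, so the parameter `ζ` of a polytope point `q = x_{j,0} + Dsc_j ζ` is determined coordinatewise and
bounded by `rB_j` (the Farkas clause `EntryOK`, `entryOK_of_checkEntryV` / `entry_coords`). [folklore] -/
theorem hentry_of_checkEntryV (hE : ∀ j, j ≤ TV.base.N₀ → TV.checkEntryV j = true) {j : ℕ} (hj : j ≤ TV.base.N₀)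
    (q ζ : Fin 4 → ℤ → ℝ) (hq : InPoly (TV.toCertDataVW kitOf wT sc) j q)
    (hqζ : ∀ i k, -(TV.toCertDataVW kitOf wT sc).Kb ≤ k → k ≤ (TV.toCertDataVW kitOf wT sc).Ka →
      q i k = ((TV.toCertDataVW kitOf wT sc).x j 0 + (TV.toRadiiW kitOf wT).Dsc j ζ) i k)
    {c : ℕ} (hc : c < TV.base.n) : |TV.base.wv ζ c| ≤ (dget (TV.stageV j).rB c).toReal := by
  -- `0 < D_c` from the entry check
  have hcheck := allBelow_eq_true.1 (hE j hj)
  obtain ⟨-, hbd⟩ := Bool.and_eq_true_iff.1 (hcheck c hc)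
  unfold entryBdOK at hbd
  obtain ⟨hD, -⟩ := Bool.and_eq_true_iff.1 hbd
  have hDpos : 0 < vre (TV.stageV j).D c := by
    have := (Dyad.blt_iff _ _).1 hD; rw [Dyad.toReal_zero] at this; exact this
  -- the Farkas parameter `ζ₀` of `q`
  obtain ⟨ζ₀, hζ₀, hq₀, -⟩ := TV.entry_coords kitOf wT sc (entryOK_of_checkEntryV kitOf wT sc hE) hj hq
  -- `wv q c = yb_c + D_c · wv ζ c` from `hqζ`
  have hk := TV.base.InW_wk hc
  have h1 : TV.base.wv q c = vre (TV.stageV j).yb c + vre (TV.stageV j).D c * TV.base.wv ζ c := by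
    rw [← TV.wv_xR_zero j hc, ← TV.wv_Dsc kitOf wT j ζ hc, ← TV.base.wv_add]
    exact hqζ (TV.base.wi c) (TV.base.wk c) hk.1 hk.2
  -- hence `wv ζ c = wv ζ₀ c`
  have h2 : TV.base.wv ζ c = TV.base.wv ζ₀ c := by
    have := h1.symm.trans (hq₀ c hc)
    exact mul_left_cancel₀ hDpos.ne' (by linarith)
  rw [h2]
  exact hζ₀ c hc

/-- **THE v3 CLOSER WITH THE READ-OUTS COMPOSER WIRED IN.** As `k1bDR_of_checksV`, with `ReadoutsV` replaced by typer g32's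
`readoutsV_of_checks` (p631126): the read-out Boolean `checkReadouts`, and the (R0)–(R3) inputs that the growth/scalar checks of
the K-side supply — per stage `j ≤ N₀`: (R0) `Tn S ≤ τs`, the base point lies in its polytope, `0 < γ`, `0 ≤ ΛT` ((R0e) `σf` reads the
window is discharged here); (R1) the tube hull; (R2) the growth table `G`; (R3) the `Λ`/`ΛT` products — and NOTHING ELSE
(the entry box `hentry` is discharged from `checkEntryV`). `ro := TV.toReadoutData kitOf wT A G ΛT`. [folklore] -/
theorem k1bDR_of_checksVR (A : ReadoutAux QS2) (B : StageAux QS2) (B'' : StaticAux QS2)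
    (hcoef : TV.base.checkCoef = true) (hS : TV.base.checkStatic B'' = true)
    (hSN : TV.base.checkStageNumerics A B = true) (hk : KitOK TV kitOf) (hC : ChecksOK TV kitOf wT)
    (hK : CoreChecksOK TV wT) (hE : ∀ j, j ≤ TV.base.N₀ → TV.checkEntryV j = true)
    (hchk : TV.checkReadouts kitOf wT A = true) {G : ℕ → ℕ → ℕ → ℝ} {ΛT : ℕ → ℝ}
    (hR0 : ∀ j, j ≤ TV.base.N₀ →
      (TV.toCertDataVW kitOf wT sc).Tn j ((TV.toCertDataVW kitOf wT sc).S j) ≤ (TV.toCertDataVW kitOf wT sc).τs ∧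
      InPoly (TV.toCertDataVW kitOf wT sc) j ((TV.toCertDataVW kitOf wT sc).x j 0) ∧
      0 < (TV.toCertDataVW kitOf wT sc).γ j ∧ 0 ≤ ΛT j)
    (hR1 : ∀ j, j ≤ TV.base.N₀ → ∀ s', s' ≤ (TV.toCertDataVW kitOf wT sc).S j → ∀ y d : Fin 4 → ℤ → ℝ,
      InBox (TV.toCertDataVW kitOf wT sc) ((TV.toBoxesW kitOf wT).hlo 1 j s') ((TV.toBoxesW kitOf wT).hhi 1 j s') y →
      (TV.toCertDataVW kitOf wT sc).InBall j d (ΛT j * (TV.toCertDataVW kitOf wT sc).κ j) →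
      InBox (TV.toCertDataVW kitOf wT sc) ((TV.toBoxesW kitOf wT).hlo 2 j s') ((TV.toBoxesW kitOf wT).hhi 2 j s') (y + d))
    (hR2 : ∀ j, j ≤ TV.base.N₀ → ∀ s₀ s₁, s₀ ≤ s₁ → s₁ ≤ (TV.toCertDataVW kitOf wT sc).S j → ∀ Ac : ℕ → Ker,
      (∀ s', s₀ ≤ s' → s' < s₁ →
        KerMem (TV.toCertDataVW kitOf wT sc) (Ac s') ((TV.toBoxesW kitOf wT).Mlo j s') ((TV.toBoxesW kitOf wT).Mhi j s')) →
      ∀ (v : Fin 4 → ℤ → ℝ) (r : ℝ), 0 ≤ r → (TV.toCertDataVW kitOf wT sc).InBall j v r →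
        (TV.toCertDataVW kitOf wT sc).InBall j (kiter (TV.toCertDataVW kitOf wT sc) Ac s₀ (s₁ - s₀) v) (G j s₀ s₁ * r))
    (hR3a : ∀ j, j ≤ TV.base.N₀ → ∀ a b, a < (TV.toCertDataVW kitOf wT sc).S j → a + 1 ≤ b →
      b ≤ (TV.toCertDataVW kitOf wT sc).S j →
      (TV.toCertDataVW kitOf wT sc).L1 j a * G j (a + 1) b ≤ ΛT j ∧
      (b < (TV.toCertDataVW kitOf wT sc).S j →
        (TV.toCertDataVW kitOf wT sc).L1 j a * G j (a + 1) b * (TV.toCertDataVW kitOf wT sc).L1 j b ≤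
          (TV.toCertDataVW kitOf wT sc).Λ j))
    (hR3b : ∀ j, j ≤ TV.base.N₀ → ∀ a, a < (TV.toCertDataVW kitOf wT sc).S j →
      (TV.toCertDataVW kitOf wT sc).L1 j a ≤ (TV.toCertDataVW kitOf wT sc).Λ j) :
    Summit.NavierStokesRegularity.NavierStokesRegularity.Theses.ExactWindowRungThree.DerivativeEnclosureCertificateR :=
  TV.k1bDR_of_checksV kitOf wT sc A B B'' hcoef hS hSN hk hC hK hE
    (readoutsV_of_checks (sc := sc) (G := G) (ΛT := ΛT) hk hchk
      (fun j hj => ⟨(hR0 j hj).1, (hR0 j hj).2.1, (hR0 j hj).2.2.1, (hR0 j hj).2.2.2, TV.sigma_trunc_VW kitOf wT sc j⟩)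
      hR1 hR2 hR3a hR3b
      (fun _ hj q ζ hq hqζ _ hc => TV.hentry_of_checkEntryV kitOf wT sc hE hj q ζ hq hqζ hc))

/-! ### Appended (tm-g4 g4, after typer g33's `readoutsV_of_checks'` p634935): the checkpoint form of the read-outs -/

/-- **THE v3 CLOSER, CHECKPOINT FORM OF THE READ-OUTS** (engine-1 g67 12:36Z (3)): as `k1bDR_of_checksVR` with typer g33's
`readoutsV_of_checks'` — the read-out Boolean `checkReadouts'` (read-out step from the emitted nodes `S−1`, `S`) and the per-sub-step
(R4) facts `hR4` (delivered by the chunk runs: `StageCtx.checkRangeP_sound` or `CertTablesV.steps_of_growth`). [folklore] -/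
theorem k1bDR_of_checksVR' (A : ReadoutAux QS2) (B : StageAux QS2) (B'' : StaticAux QS2)
    (hcoef : TV.base.checkCoef = true) (hS : TV.base.checkStatic B'' = true)
    (hSN : TV.base.checkStageNumerics A B = true) (hk : KitOK TV kitOf) (hC : ChecksOK TV kitOf wT)
    (hK : CoreChecksOK TV wT) (hE : ∀ j, j ≤ TV.base.N₀ → TV.checkEntryV j = true)
    (hchk' : TV.checkReadouts' kitOf wT A = true)
    (hR4 : ∀ j, j ≤ TV.base.N₀ → ∀ s, s < (TV.base.stage j).S → TV.base.testR4 TV.MB (TV.AB j) (TV.coreVW kitOf wT j s) = true)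
    {G : ℕ → ℕ → ℕ → ℝ} {ΛT : ℕ → ℝ}
    (hR0 : ∀ j, j ≤ TV.base.N₀ →
      (TV.toCertDataVW kitOf wT sc).Tn j ((TV.toCertDataVW kitOf wT sc).S j) ≤ (TV.toCertDataVW kitOf wT sc).τs ∧
      InPoly (TV.toCertDataVW kitOf wT sc) j ((TV.toCertDataVW kitOf wT sc).x j 0) ∧
      0 < (TV.toCertDataVW kitOf wT sc).γ j ∧ 0 ≤ ΛT j)
    (hR1 : ∀ j, j ≤ TV.base.N₀ → ∀ s', s' ≤ (TV.toCertDataVW kitOf wT sc).S j → ∀ y d : Fin 4 → ℤ → ℝ,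
      InBox (TV.toCertDataVW kitOf wT sc) ((TV.toBoxesW kitOf wT).hlo 1 j s') ((TV.toBoxesW kitOf wT).hhi 1 j s') y →
      (TV.toCertDataVW kitOf wT sc).InBall j d (ΛT j * (TV.toCertDataVW kitOf wT sc).κ j) →
      InBox (TV.toCertDataVW kitOf wT sc) ((TV.toBoxesW kitOf wT).hlo 2 j s') ((TV.toBoxesW kitOf wT).hhi 2 j s') (y + d))
    (hR2 : ∀ j, j ≤ TV.base.N₀ → ∀ s₀ s₁, s₀ ≤ s₁ → s₁ ≤ (TV.toCertDataVW kitOf wT sc).S j → ∀ Ac : ℕ → Ker,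
      (∀ s', s₀ ≤ s' → s' < s₁ →
        KerMem (TV.toCertDataVW kitOf wT sc) (Ac s') ((TV.toBoxesW kitOf wT).Mlo j s') ((TV.toBoxesW kitOf wT).Mhi j s')) →
      ∀ (v : Fin 4 → ℤ → ℝ) (r : ℝ), 0 ≤ r → (TV.toCertDataVW kitOf wT sc).InBall j v r →
        (TV.toCertDataVW kitOf wT sc).InBall j (kiter (TV.toCertDataVW kitOf wT sc) Ac s₀ (s₁ - s₀) v) (G j s₀ s₁ * r))
    (hR3a : ∀ j, j ≤ TV.base.N₀ → ∀ a b, a < (TV.toCertDataVW kitOf wT sc).S j → a + 1 ≤ b →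
      b ≤ (TV.toCertDataVW kitOf wT sc).S j →
      (TV.toCertDataVW kitOf wT sc).L1 j a * G j (a + 1) b ≤ ΛT j ∧
      (b < (TV.toCertDataVW kitOf wT sc).S j →
        (TV.toCertDataVW kitOf wT sc).L1 j a * G j (a + 1) b * (TV.toCertDataVW kitOf wT sc).L1 j b ≤
          (TV.toCertDataVW kitOf wT sc).Λ j))
    (hR3b : ∀ j, j ≤ TV.base.N₀ → ∀ a, a < (TV.toCertDataVW kitOf wT sc).S j →
      (TV.toCertDataVW kitOf wT sc).L1 j a ≤ (TV.toCertDataVW kitOf wT sc).Λ j) :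
    Summit.NavierStokesRegularity.NavierStokesRegularity.Theses.ExactWindowRungThree.DerivativeEnclosureCertificateR :=
  TV.k1bDR_of_checksV kitOf wT sc A B B'' hcoef hS hSN hk hC hK hE
    (readoutsV_of_checks' (sc := sc) (G := G) (ΛT := ΛT) hk hchk' hR4
      (fun j hj => ⟨(hR0 j hj).1, (hR0 j hj).2.1, (hR0 j hj).2.2.1, (hR0 j hj).2.2.2, TV.sigma_trunc_VW kitOf wT sc j⟩)
      hR1 hR2 hR3a hR3b
      (fun _ hj q ζ hq hqζ _ hc => TV.hentry_of_checkEntryV kitOf wT sc hE hj q ζ hq hqζ hc))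

/-! ### Appended (tm-g4 g4): THE FINAL CLOSER SHAPE — (R0)–(R3) discharged by the growth checker (`…FormatVGrowth/Run/Pairs/Sound`) -/

/-- **THE v3 CLOSER FROM BOOLEANS.** Every semantic input of `k1bDR_of_checksVR'` is discharged by a replayed Boolean:
the v1 blocks (`checkCoef`, `checkStatic`, `checkStageNumerics` on `TV.base`), the kit (`KitOK`, e.g. `kitOK_stdKit`), the entry node
frame tests `nodeOK`, `rB ≥ 0`, `CoreChecksOK`, the sparse-Farkas entry tests `checkEntryV`, the checkpoint-form read-outs
`checkReadouts'`, and — NEW — the GROWTH CHUNK RUNS `growthRange (testR4-predicate) j L q = true` for every stage `j ≤ N₀` and chunk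
`q` with `qL < S_j` (ONE forward replay per chunk delivering the chain Booleans `ChecksOK.steps`, the read-outs' (R4) facts, and the
tube-growth table with its tests), `checkL1 j` ((R3b)), `checkR0 j` ((R0)), `checkR1 j` ((R1)); `G := Gr … L`, `ΛT := ΛTr` (= `Λdes`).
What remains for the crux is ONE emitted v3 certificate (with the growth data `landAux = [gL1; ũ; T̃_0, T̃_1, …]`) on which these
Booleans evaluate to `true`. (`sc`: the v1 per-node scalars of the interpreted record — unused by the v3 chain, any value.) [folklore] -/
theorem k1bDR_of_checksVRG' (sc : ScalarsV) (A : ReadoutAux QS2) (B : StageAux QS2) (B'' : StaticAux QS2)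
    (hcoef : TV.base.checkCoef = true) (hS : TV.base.checkStatic B'' = true)
    (hSN : TV.base.checkStageNumerics A B = true) (hk : KitOK TV kitOf)
    (hnode0 : ∀ j, j ≤ TV.base.N₀ → nodeOK TV.base.n TV.prec (TV.ctxOfW kitOf wT j).N0 = true)
    (hrB : ∀ j, j ≤ TV.base.N₀ → nonnegVec TV.base.n (TV.stageV j).rB = true)
    (hK : CoreChecksOK TV wT) (hE : ∀ j, j ≤ TV.base.N₀ → TV.checkEntryV j = true)
    (hchk' : TV.checkReadouts' kitOf wT A = true) {L : ℕ} (hL : 0 < L)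
    (hGR : ∀ j, j ≤ TV.base.N₀ → ∀ q, q * L < TV.S j →
      TV.growthRange kitOf wT (fun _ co => TV.base.testR4 TV.MB (TV.AB j) co) j L q = true)
    (hcL : ∀ j, j ≤ TV.base.N₀ → TV.checkL1 j = true) (hc0 : ∀ j, j ≤ TV.base.N₀ → TV.checkR0 j = true)
    (hc1 : ∀ j, j ≤ TV.base.N₀ → TV.checkR1 wT j = true) :
    Summit.NavierStokesRegularity.NavierStokesRegularity.Theses.ExactWindowRungThree.DerivativeEnclosureCertificateR :=
  have hsteps := steps_of_growth (TV := TV) (kitOf := kitOf) (wT := wT)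
    (Pj := fun j _ co => TV.base.testR4 TV.MB (TV.AB j) co) hL hGR
  TV.k1bDR_of_checksVR' kitOf wT sc A B B'' hcoef hS hSN hk ⟨hnode0, hrB, fun j hj s hs => (hsteps j hj s hs).1⟩ hK hE hchk'
    (fun j hj s hs => (hsteps j hj s hs).2) (G := fun j => TV.Gr kitOf wT j L) (ΛT := TV.ΛTr)
    (hR0_all (sc := sc) hc0) (hR1_all (sc := sc) hc1)
    (hR2_all (sc := sc) hL hGR (TV.stageNumerics_of_checkV kitOf wT sc A B hcoef hSN))
    (hR3a_all (sc := sc) hL hGR) (hR3b_all (sc := sc) hL hGR hcL)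

/-! ### Appended (tm-g4 g4): the closer for the TWO-LEVEL growth checker (variant B, `…FormatVGrowth2*`) -/

/-- **THE v3 CLOSER FROM BOOLEANS, TWO-LEVEL GROWTH VARIANT**: as `k1bDR_of_checksVRG'` with the chunk runs
`growthRange2 … j L ℓ q` (sub-blocks of length `ℓ ∣ L`; `G := Gr2 … L ℓ`). [folklore] -/
theorem k1bDR_of_checksVRG2' (sc : ScalarsV) (A : ReadoutAux QS2) (B : StageAux QS2) (B'' : StaticAux QS2)
    (hcoef : TV.base.checkCoef = true) (hS : TV.base.checkStatic B'' = true)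
    (hSN : TV.base.checkStageNumerics A B = true) (hk : KitOK TV kitOf)
    (hnode0 : ∀ j, j ≤ TV.base.N₀ → nodeOK TV.base.n TV.prec (TV.ctxOfW kitOf wT j).N0 = true)
    (hrB : ∀ j, j ≤ TV.base.N₀ → nonnegVec TV.base.n (TV.stageV j).rB = true)
    (hK : CoreChecksOK TV wT) (hE : ∀ j, j ≤ TV.base.N₀ → TV.checkEntryV j = true)
    (hchk' : TV.checkReadouts' kitOf wT A = true) {L ℓ : ℕ} (hL : 0 < L) (hℓ : 0 < ℓ) (hdvd : ℓ ∣ L)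
    (hGR : ∀ j, j ≤ TV.base.N₀ → ∀ q, q * L < TV.S j →
      TV.growthRange2 kitOf wT (fun _ co => TV.base.testR4 TV.MB (TV.AB j) co) j L ℓ q = true)
    (hcL : ∀ j, j ≤ TV.base.N₀ → TV.checkL1 j = true) (hc0 : ∀ j, j ≤ TV.base.N₀ → TV.checkR0 j = true)
    (hc1 : ∀ j, j ≤ TV.base.N₀ → TV.checkR1 wT j = true) :
    Summit.NavierStokesRegularity.NavierStokesRegularity.Theses.ExactWindowRungThree.DerivativeEnclosureCertificateR :=
  have hsteps := steps_of_growth2 (TV := TV) (kitOf := kitOf) (wT := wT)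
    (Pj := fun j _ co => TV.base.testR4 TV.MB (TV.AB j) co) hℓ hdvd hL hGR
  TV.k1bDR_of_checksVR' kitOf wT sc A B B'' hcoef hS hSN hk ⟨hnode0, hrB, fun j hj s hs => (hsteps j hj s hs).2⟩ hK hE hchk'
    (fun j hj s hs => (hsteps j hj s hs).1) (G := fun j => TV.Gr2 kitOf wT j L ℓ) (ΛT := TV.ΛTr)
    (hR0_all (sc := sc) hc0) (hR1_all (sc := sc) hc1)
    (hR2_all2 (sc := sc) hℓ hdvd hL hGR (TV.stageNumerics_of_checkV kitOf wT sc A B hcoef hSN))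
    (hR3a_all2 (sc := sc) hℓ hdvd hL hGR) (fun j hj a ha => (hR3b_all2 (sc := sc) hℓ hdvd hL hGR hcL j hj a ha).1)

end CertTablesV

end Summit.NavierStokesRegularity.NavierStokesRegularity.Theorems.TaylorModelCert
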